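import Summits.ResolutionOfSingularities.ResolutionOfSingularities.Theorems.FrobeniusClosingPatchingRelPerfectDepthSNCExchange
import Summits.ResolutionOfSingularities.ResolutionOfSingularities.Theorems.FrobeniusClosingPatchingRelPerfectDepthSNCSwap
import Literature.AlgebraicGeometry.Resolution.SncParameterExchange
import Literature.AlgebraicGeometry.Resolution.HypersurfacePushforward
import Literature.AlgebraicGeometry.Resolution.StalkIdealLemmas
import HarnessLib

/-!
# Crux `PatchingRelPerfect` (stmt-ResolutionOfSingularities-16161), chain W5.2 — F6 stage 2, T6-X2 support
# TRACE → COTANGENT feeder: reading the E-side order / coincidence conditions in `𝔪_x/𝔪_x²` along a closed immersion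

[OURS · L1 W5.2 · F6 · T6-X2 brick «021 RE-POINT» dealt to res-D-pv-021 by res-D-pv-016 AS w52-stub-5 (2026-08-27T09:50:32Z);
custody res-plan-2 #5x] Pure PROOFS, no definitions, no named facts. For a closed immersion `i : E ⟶ X`, a point `z ∈ E`,
`x = i z`, an X-side ideal sheaf `𝓗` («host») with principal stalk `𝓗_x = (F)`, and its trace `𝔟 = 𝓗|_E = 𝓗.comap i`:
the stalk map `φ = i^*_z : 𝒪_{X,x} → 𝒪_{E,z}` is SURJECTIVE with kernel `(𝓘_E)_x` (`ker_stalkMap_of_isClosedImmersion`),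
`𝔟_z = φ(𝓗_x)` (`stalkIdeal_comap_eq_map_stalkMap`) and `φ(𝔪_x) = 𝔪_z`, so E-side conditions on `𝔟_z` lift to cotangent
conditions on `F` — exactly the inputs `hin` / `hout` of res-D-pv-009's pointwise swaps (`SNCWithAt.swap`,
`tangent_swap`, `coincidence_swap`, p519194) at the centre points of a stage-2 step (`stepSepOne_holds`):

* (α) `mem_ker_sup_sq_of_comap_le_sq` — `𝔟_z ⊆ 𝔪_z²` («`ord_z 𝔟 ≥ 2`», `¬ OrdLeOneAt`) ⟹ `F ∈ (𝓘_E)_x + 𝔪_x²` (TANGENCY: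
  `tangent_swap`'s `hin`);
* (β) `not_mem_ker_sup_sq_of_not_comap_le_sq` — `𝔟_z ⊄ 𝔪_z²` (`OrdLeOneAt`) ⟹ `F ∉ (𝓘_E)_x + 𝔪_x²` (`swap`'s `hout` with
  `M′ = [𝓘_E]`); and the iff `comap_le_sq_iff_mem_ker_sup_sq`;
* (γ) `mem_sup_ker_of_comap_le` — `𝔟_z ⊆ (G|_E)_z` ⟹ `F ∈ G_x + (𝓘_E)_x` (COINCIDENCE: `coincidence_swap`'s `hin`);
* (δ) `not_mem_sup_sq_of_sncWithAt_pair` — `SNCWithAt [𝓗, G] ⊤ x`, `x ∈ V(G)`, `G_x ≠ 𝓗_x` ⟹ `F ∉ G_x + 𝔪_x²`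
  (`coincidence_swap`'s `hout`, from the format's transversality clause «`𝓗 ⋔ G`»);
* (ε) `sncWithAt_pair_of_not_mem_sup_sq` — conversely `F ∈ 𝔪_x`, `G_x = (w)`, `w ∈ 𝔪_x ∖ 𝔪_x²`, `F ∉ G_x + 𝔪_x²`, `𝒪_{X,x}`
  regular ⟹ `SNCWithAt [𝓗, G] ⊤ x` (one parameter exchange in a regular system extending `w`: Literature
  `exists_rsop_apply_eq`-pattern via `exists_isUnit_coeff_of_not_mem` + `rsop_update`) — what the E′-half of `EndTwoMonomialSep`
  reads.

AI-written; AI review is weaker than expert review. Nothing here is a statement of the manuscript under review.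

## References
* H. Matsumura, *Commutative Ring Theory* (1986), Thm. 14.2. [Matsumura1987]
* J. Kollár, *Lectures on Resolution of Singularities* (2007), Cor. 3.85, 3.104 Step 2.1. [Kollar2007]
-/

-- `Summit.<Summit>.<Sub>.Theorems` with `Sub = Summit` (single-conjunct summit, D-0017)
set_option linter.dupNamespace false

noncomputable section

open CategoryTheory CategoryTheory.Limits AlgebraicGeometry TopologicalSpace IsLocalRing
open Literature.AlgebraicGeometry.Resolution

namespace Summit.ResolutionOfSingularities.ResolutionOfSingularities.Theorems.DepthSNC

universe u

section Trace

variable {E X : Scheme.{u}} (i : E ⟶ X) [IsClosedImmersion i] (𝓗 : X.IdealSheafData) (z : E)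

/-- The maximal ideal of `𝒪_{E,z}` is the image of that of `𝒪_{X,iz}` under the (surjective) stalk map of the closed
immersion; hence so is its square. [folklore] -/
theorem map_stalkMap_maximalIdeal_sq :
    (maximalIdeal (X.presheaf.stalk (i.base z)) ^ 2).map (i.stalkMap z).hom = maximalIdeal (E.presheaf.stalk z) ^ 2 := by
  rw [Ideal.map_pow, map_maximalIdeal_of_surjective _ (i.stalkMap_surjective z)]

/-- **Pulling a condition on the trace back to `𝒪_{X,x}`**: for an ideal `I ⊆ 𝒪_{X,x}`, `𝔟_z ⊆ φ(I)` iff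
`𝓗_x ⊆ I + (𝓘_E)_x` (`φ = i^*_z` surjective with kernel `(𝓘_E)_x`). [folklore] -/
theorem stalkIdeal_comap_le_map_iff (I : Ideal (X.presheaf.stalk (i.base z))) :
    stalkIdeal (𝓗.comap i) z ≤ I.map (i.stalkMap z).hom ↔
      stalkIdeal 𝓗 (i.base z) ≤ I ⊔ stalkIdeal i.ker (i.base z) := by
  rw [stalkIdeal_comap_eq_map_stalkMap, Ideal.map_le_iff_le_comap,
    Ideal.comap_map_of_surjective _ (i.stalkMap_surjective z), ← RingHom.ker_eq_comap_bot,
    ker_stalkMap_of_isClosedImmersion i z]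

variable {i 𝓗 z}

/-- (α)+(β) as an iff: **`ord_z (𝓗|_E) ≥ 2 ⟺ F ∈ (𝓘_E)_x + 𝔪_x²`** for a generator `F` of `𝓗_x`, `x = i z`. [cite: Kollar2007, Cor. 3.85] -/
theorem comap_le_sq_iff_mem_ker_sup_sq {F : X.presheaf.stalk (i.base z)} (h𝓗 : stalkIdeal 𝓗 (i.base z) = Ideal.span {F}) :
    stalkIdeal (𝓗.comap i) z ≤ maximalIdeal (E.presheaf.stalk z) ^ 2 ↔
      F ∈ stalkIdeal i.ker (i.base z) ⊔ maximalIdeal (X.presheaf.stalk (i.base z)) ^ 2 := by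
  rw [← map_stalkMap_maximalIdeal_sq i z, stalkIdeal_comap_le_map_iff, h𝓗, Ideal.span_singleton_le_iff_mem, sup_comm]

/-- (α) **TANGENCY read in the cotangent space**: `ord_z (𝓗|_E) ≥ 2` (`(𝓗|_E)_z ⊆ 𝔪_z²`, i.e. `¬ OrdLeOneAt`) ⟹
`F ∈ (𝓘_E)_x + 𝔪_x²` — the `hin` of res-D-pv-009's `SNCWithAt.tangent_swap` (the host is tangent to `E` at `x`).
[cite: Kollar2007, Cor. 3.85] -/
theorem mem_ker_sup_sq_of_comap_le_sq {F : X.presheaf.stalk (i.base z)} (h𝓗 : stalkIdeal 𝓗 (i.base z) = Ideal.span {F})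
    (hle : stalkIdeal (𝓗.comap i) z ≤ maximalIdeal (E.presheaf.stalk z) ^ 2) :
    F ∈ stalkIdeal i.ker (i.base z) ⊔ maximalIdeal (X.presheaf.stalk (i.base z)) ^ 2 :=
  (comap_le_sq_iff_mem_ker_sup_sq h𝓗).mp hle

/-- (β) **ORDER ONE read in the cotangent space**: `(𝓗|_E)_z ⊄ 𝔪_z²` (`OrdLeOneAt`) ⟹ `F ∉ (𝓘_E)_x + 𝔪_x²` — the `hout` of
`SNCWithAt.swap` with `M′ = [𝓘_E]` (the host is transversal to `E` at `x`). [cite: Kollar2007, Cor. 3.85] -/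
theorem not_mem_ker_sup_sq_of_not_comap_le_sq {F : X.presheaf.stalk (i.base z)}
    (h𝓗 : stalkIdeal 𝓗 (i.base z) = Ideal.span {F})
    (hne : ¬ stalkIdeal (𝓗.comap i) z ≤ maximalIdeal (E.presheaf.stalk z) ^ 2) :
    F ∉ stalkIdeal i.ker (i.base z) ⊔ maximalIdeal (X.presheaf.stalk (i.base z)) ^ 2 :=
  fun h => hne ((comap_le_sq_iff_mem_ker_sup_sq h𝓗).mpr h)

/-- (γ) **COINCIDENCE read upstairs**: `(𝓗|_E)_z ⊆ (G|_E)_z` ⟹ `F ∈ G_x + (𝓘_E)_x` — the `hin` of res-D-pv-009's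
`SNCWithAt.coincidence_swap`. [cite: Kollar2007, Cor. 3.85] -/
theorem mem_sup_ker_of_comap_le {G : X.IdealSheafData} {F : X.presheaf.stalk (i.base z)}
    (h𝓗 : stalkIdeal 𝓗 (i.base z) = Ideal.span {F})
    (hle : stalkIdeal (𝓗.comap i) z ≤ stalkIdeal (G.comap i) z) :
    F ∈ stalkIdeal G (i.base z) ⊔ stalkIdeal i.ker (i.base z) := by
  rw [stalkIdeal_comap_eq_map_stalkMap i G z] at hle
  have h := (stalkIdeal_comap_le_map_iff i 𝓗 z _).mp hle
  rw [h𝓗, Ideal.span_singleton_le_iff_mem] at h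
  exact h

/-- (γ′) The same from an EQUALITY of traces (`CoincidesAt` currency). [folklore] -/
theorem mem_sup_ker_of_comap_eq {G : X.IdealSheafData} {F : X.presheaf.stalk (i.base z)}
    (h𝓗 : stalkIdeal 𝓗 (i.base z) = Ideal.span {F})
    (heq : stalkIdeal (G.comap i) z = stalkIdeal (𝓗.comap i) z) :
    F ∈ stalkIdeal G (i.base z) ⊔ stalkIdeal i.ker (i.base z) :=
  mem_sup_ker_of_comap_le h𝓗 heq.symm.le

end Trace

/-! ## Transversality of the pair `{𝓗, G}` at a point, in the cotangent space -/

section Pair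

variable {X : Scheme.{u}} {𝓗 G : X.IdealSheafData} {x : X}

/-- (δ) **`𝓗 ⋔ G` read in the cotangent space**: if `[𝓗, G]` has simple normal crossings at `x ∈ V(G)` and `G_x ≠ 𝓗_x`,
then a generator `F` of `𝓗_x` does NOT lie in `G_x + 𝔪_x²` — the `hout` of `SNCWithAt.coincidence_swap` (rsop independence modulo
`𝔪²`, Literature `rsop_not_mem_span_image_sup_sq`). [cite: Matsumura1987, Thm. 14.2] -/
theorem not_mem_sup_sq_of_sncWithAt_pair (h : SNCWithAt [𝓗, G] ⊤ x) (hx𝓗 : x ∈ 𝓗.support) (hxG : x ∈ G.support)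
    (hne : stalkIdeal G x ≠ stalkIdeal 𝓗 x) {F : X.presheaf.stalk x} (h𝓗 : stalkIdeal 𝓗 x = Ideal.span {F}) :
    F ∉ stalkIdeal G x ⊔ maximalIdeal (X.presheaf.stalk x) ^ 2 := by
  classical
  intro hF
  obtain ⟨hreg, d, v, hd, hv, ⟨ι, hι, hιD⟩, -⟩ := h
  haveI := hreg
  set a : Fin d := ι ⟨𝓗, List.mem_cons_self, hx𝓗⟩ with ha
  set b : Fin d := ι ⟨G, List.mem_cons_of_mem _ List.mem_cons_self, hxG⟩ with hb
  have h𝓗v : stalkIdeal 𝓗 x = Ideal.span {v a} := hιD ⟨𝓗, List.mem_cons_self, hx𝓗⟩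
  have hGv : stalkIdeal G x = Ideal.span {v b} := hιD ⟨G, List.mem_cons_of_mem _ List.mem_cons_self, hxG⟩
  have hab : a ≠ b := by
    intro heq
    apply hne
    rw [hGv, h𝓗v, heq]
  -- `v a = c F`, `F ∈ (v b) + 𝔪²` ⟹ `v a ∈ (v b) + 𝔪²`
  have hva : v a ∈ stalkIdeal 𝓗 x := h𝓗v ▸ Ideal.mem_span_singleton_self _
  rw [h𝓗, Ideal.mem_span_singleton] at hva
  obtain ⟨c, hc⟩ := hva
  have hmem : v a ∈ Ideal.span (v '' {b}) ⊔ maximalIdeal (X.presheaf.stalk x) ^ 2 := by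
    rw [Set.image_singleton, ← hGv, hc]
    exact Ideal.mul_mem_right _ _ hF
  exact rsop_not_mem_span_image_sup_sq hd v hv (T := {b}) (a := a) (fun h => hab h) hmem

/-- (ε) **The converse, for the END**: `𝒪_{X,x}` regular, `𝓗_x = (F)` with `F ∈ 𝔪_x`, `G_x = (w)` with `w ∈ 𝔪_x ∖ 𝔪_x²`, and
`F ∉ G_x + 𝔪_x²` ⟹ `[𝓗, G]` has simple normal crossings at `x`: extend `w` to a regular system of parameters `v` (`v b = w`),
write `F = Σ c_j v_j`; as `F ∉ (v b) + 𝔪²` some `j ≠ b` has a unit coefficient (`exists_isUnit_coeff_of_not_mem`), and the exchange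
`v_j ↦ F` (`rsop_update`) is a regular system exhibiting both members. [cite: Matsumura1987, Thm. 14.2] [cite: Kollar2007, Cor. 3.85] -/
theorem sncWithAt_pair_of_not_mem_sup_sq (hreg : IsRegularLocalRing (X.presheaf.stalk x)) {F w : X.presheaf.stalk x}
    (h𝓗 : stalkIdeal 𝓗 x = Ideal.span {F}) (hF𝔪 : F ∈ maximalIdeal (X.presheaf.stalk x))
    (hG : stalkIdeal G x = Ideal.span {w}) (hw : w ∈ maximalIdeal (X.presheaf.stalk x))
    (hw2 : w ∉ maximalIdeal (X.presheaf.stalk x) ^ 2)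
    (hF : F ∉ stalkIdeal G x ⊔ maximalIdeal (X.presheaf.stalk x) ^ 2) :
    SNCWithAt [𝓗, G] ⊤ x := by
  classical
  haveI := hreg
  set d := (maximalIdeal (X.presheaf.stalk x)).spanFinrank with hd
  -- a regular system `z` with `z b₀ = w`
  have hd0 : 0 < d := by
    by_contra h0
    have hd00 : (maximalIdeal (X.presheaf.stalk x)).spanFinrank = 0 := by omega
    have hbot : maximalIdeal (X.presheaf.stalk x) = ⊥ :=
      Submodule.spanFinrank_eq_zero_iff_eq_bot (IsNoetherian.noetherian _) |>.mp hd00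
    apply hw2
    rw [hbot] at hw
    rw [(Submodule.mem_bot _).mp hw]
    exact zero_mem _
  set b₀ : Fin d := ⟨0, hd0⟩ with hb₀
  obtain ⟨zv, hz, hzb⟩ := exists_rsop_apply_eq hd.symm hw hw2 b₀
  -- `F = Σ_j c_j z_j` with a unit coefficient at some `j₀ ≠ b₀`
  have hFspan : F ∈ Ideal.span (zv '' (Finset.univ : Finset (Fin d))) := by
    rw [Finset.coe_univ, Set.image_univ, hz]; exact hF𝔪
  have hFnot : F ∉ Ideal.span (zv '' ({b₀} : Set (Fin d))) ⊔ maximalIdeal (X.presheaf.stalk x) ^ 2 := by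
    rwa [Set.image_singleton, hzb, ← hG]
  obtain ⟨c, -, hcF⟩ := exists_coeff_of_mem_span_image zv (Set.univ : Set (Fin d)) (h := F)
    (by rw [Set.image_univ, hz]; exact hF𝔪)
  have hsum : ∑ j ∈ (Finset.univ : Finset (Fin d)), c j * zv j = F := hcF
  have hFnot : ∑ j ∈ (Finset.univ : Finset (Fin d)), c j * zv j ∉
      Ideal.span (zv '' ({b₀} : Set (Fin d))) ⊔ maximalIdeal (X.presheaf.stalk x) ^ 2 := by
    rw [hsum, Set.image_singleton, hzb, ← hG]; exact hF
  obtain ⟨j₀, -, hj₀b, hu⟩ := exists_isUnit_coeff_of_not_mem zv hz Finset.univ ({b₀} : Set (Fin d)) c hFnot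
  have hj₀b' : j₀ ≠ b₀ := fun h => hj₀b (h ▸ Set.mem_singleton b₀)
  -- the exchange `z_{j₀} ↦ F`
  obtain ⟨hv', -⟩ := rsop_update zv hz Finset.univ c (Finset.mem_univ j₀) hu
  rw [hsum] at hv'
  set v' : Fin d → X.presheaf.stalk x := Function.update zv j₀ F with hv'def
  have hv'j : v' j₀ = F := Function.update_self j₀ F zv
  have hv'b : v' b₀ = w := by rw [hv'def, Function.update_of_ne hj₀b'.symm, hzb]
  -- the labelling
  refine ⟨hreg, d, v', hd.symm, hv', ⟨fun D => if D.1 = 𝓗 then j₀ else b₀, ?_, ?_⟩, fun hx => ?_⟩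
  · intro D₁ D₂ h12
    by_cases h₁ : D₁.1 = 𝓗 <;> by_cases h₂ : D₂.1 = 𝓗
    · exact Subtype.ext (h₁.trans h₂.symm)
    · simp only [h₁, h₂, if_true, if_false] at h12; exact absurd h12 hj₀b'
    · simp only [h₁, h₂, if_true, if_false] at h12; exact absurd h12.symm hj₀b'
    · have hm₁ := D₁.2.1
      have hm₂ := D₂.2.1
      simp only [List.mem_cons, List.mem_nil_iff, or_false] at hm₁ hm₂
      exact Subtype.ext ((hm₁.resolve_left h₁).trans (hm₂.resolve_left h₂).symm)
  · intro D
    by_cases h₁ : D.1 = 𝓗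
    · simp only [h₁, if_true]; rw [hv'j, h𝓗]
    · simp only [h₁, if_false]
      have hm := D.2.1
      simp only [List.mem_cons, List.mem_nil_iff, or_false] at hm
      rw [hm.resolve_left h₁, hv'b, hG]
  · rw [Scheme.IdealSheafData.support_top] at hx
    exact absurd hx id

end Pair

end Summit.ResolutionOfSingularities.ResolutionOfSingularities.Theorems.DepthSNC

end
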